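import Literature.Analysis.Complex.RiemannMapping
import HarnessLib

/-!
# Hyperbolic geometry of the unit disc, I: the invariant `cosh ρ` and the half-turns (formulas)

Topic `Literature/Analysis/Complex`.  Elementary formulas of the hyperbolic geometry of the unit
disc `𝔻 ⊆ ℂ` (Beardon, *The Geometry of Discrete Groups*, §7.2, §7.33), phrased without
transcendental functions, over the tree's Möbius maps `Complex.discMobius`
(`RiemannMapping.lean`):

* `Literature.Analysis.Complex.discCosh z w = 1 + 2‖z - w‖²/((1 - ‖z‖²)(1 - ‖w‖²))` — the
  hyperbolic cosine of the hyperbolic distance (Beardon Thm. 7.2.1 (ii):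
  `sinh²(ρ/2) = ‖z-w‖²/((1-‖z‖²)(1-‖w‖²))`), its invariance under rotations and the Möbius maps
  `φ_a` (`discCosh_discMobius`), `cosh ρ(0,w) = (1 + ‖w‖²)/(1 - ‖w‖²)`, and the value on a
  circle about the origin (`discCosh_mul_mul`);
* the **half-turn** `discHalfTurn q = φ_{-q} ∘ (z ↦ -z) ∘ φ_q` about `q ∈ 𝔻` (the geodesic
  symmetry at `q`): involutive, fixes `q`, `σ_q(0) = 2q/(1 + ‖q‖²)`, and the doubling identity
  `cosh ρ(0, σ_q(0)) = 2 cosh² ρ(0,q) - 1`.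

Part II (`UnitDiscHyperbolicAut.lean`) adds the statements involving `Aut(𝔻)`
(`UnitDiscAutomorphisms.lean`): isometric action, two-point homogeneity, uniqueness of the
half-turn.  These serve `UnitDiscAutNormalizer.lean` and the discharge of [AbsTopIII] Prop. 2.2.

## Mathlib / tree

USED: the tree's `Complex.discMobius` API (`norm_sq_one_sub_conj_mul_sub`,
`discMobius_neg_discMobius`, `injOn_discMobius`, …).  NOT here: the distance `ρ` itself
(`arcosh`), geodesics, the metric-space structure.
-/

noncomputable section

open Set Filter Metric Function
open _root_.Complex
open scoped ComplexConjugate Topology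

namespace Literature.Analysis.Complex

/-! ### The invariant `cosh ρ` -/

/-- `cosh` of the hyperbolic distance of the unit disc:
`cosh ρ(z,w) = 1 + 2‖z - w‖² / ((1 - ‖z‖²)(1 - ‖w‖²))` (Beardon Thm. 7.2.1 (ii), via
`cosh ρ = 1 + 2 sinh²(ρ/2)`).  A total real-valued function; meaningful for `z, w ∈ 𝔻`.
[cite: Beardon1983, Thm. 7.2.1] -/
def discCosh (z w : ℂ) : ℝ :=
  1 + 2 * ‖z - w‖ ^ 2 / ((1 - ‖z‖ ^ 2) * (1 - ‖w‖ ^ 2))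

/-- Unfolding `discCosh`. [cite: Beardon1983, Thm. 7.2.1] -/
theorem discCosh_apply (z w : ℂ) :
    discCosh z w = 1 + 2 * ‖z - w‖ ^ 2 / ((1 - ‖z‖ ^ 2) * (1 - ‖w‖ ^ 2)) := rfl

/-- Symmetry of `cosh ρ`. [cite: Beardon1983, Thm. 7.2.1] -/
theorem discCosh_comm (z w : ℂ) : discCosh z w = discCosh w z := by
  rw [discCosh, discCosh, norm_sub_rev, mul_comm (1 - ‖z‖ ^ 2)]

/-- `cosh ρ(z,z) = 1`. [cite: Beardon1983, Thm. 7.2.1] -/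
@[simp] theorem discCosh_self (z : ℂ) : discCosh z z = 1 := by simp [discCosh]

/-- `cosh ρ(0,w) = (1 + ‖w‖²)/(1 - ‖w‖²)` for `‖w‖ < 1`. [cite: Beardon1983, Thm. 7.2.1] -/
theorem discCosh_zero_left {w : ℂ} (hw : ‖w‖ < 1) :
    discCosh 0 w = (1 + ‖w‖ ^ 2) / (1 - ‖w‖ ^ 2) := by
  have h1 : 0 < 1 - ‖w‖ ^ 2 := by nlinarith [norm_nonneg w]
  rw [discCosh, zero_sub, norm_neg, norm_zero]
  field_simp
  ring

/-- `cosh ρ(z,w) ≥ 1` on the disc. [cite: Beardon1983, Thm. 7.2.1] -/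
theorem one_le_discCosh {z w : ℂ} (hz : ‖z‖ < 1) (hw : ‖w‖ < 1) : 1 ≤ discCosh z w := by
  have h1 : 0 < 1 - ‖z‖ ^ 2 := by nlinarith [norm_nonneg z]
  have h2 : 0 < 1 - ‖w‖ ^ 2 := by nlinarith [norm_nonneg w]
  rw [discCosh]
  have : 0 ≤ 2 * ‖z - w‖ ^ 2 / ((1 - ‖z‖ ^ 2) * (1 - ‖w‖ ^ 2)) := by positivity
  linarith

/-- `cosh ρ(z,w) = 1` iff `z = w` (on the disc). [cite: Beardon1983, Thm. 7.2.1] -/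
theorem discCosh_eq_one_iff {z w : ℂ} (hz : ‖z‖ < 1) (hw : ‖w‖ < 1) : discCosh z w = 1 ↔ z = w := by
  have h1 : 0 < 1 - ‖z‖ ^ 2 := by nlinarith [norm_nonneg z]
  have h2 : 0 < 1 - ‖w‖ ^ 2 := by nlinarith [norm_nonneg w]
  rw [discCosh, add_eq_left, div_eq_zero_iff, or_iff_left (mul_pos h1 h2).ne', mul_eq_zero,
    or_iff_right (two_ne_zero), sq_eq_zero_iff, norm_eq_zero, sub_eq_zero]

/-- On the disc, `‖w‖` is determined by `cosh ρ(0,w)`: the map `x ↦ (1+x²)/(1-x²)` is injective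
on `[0,1)`. [cite: Beardon1983, Thm. 7.2.1] -/
theorem norm_eq_norm_of_discCosh_zero_eq {w w' : ℂ} (hw : ‖w‖ < 1) (hw' : ‖w'‖ < 1)
    (h : discCosh 0 w = discCosh 0 w') : ‖w‖ = ‖w'‖ := by
  rw [discCosh_zero_left hw, discCosh_zero_left hw'] at h
  have h1 : 0 < 1 - ‖w‖ ^ 2 := by nlinarith [norm_nonneg w]
  have h2 : 0 < 1 - ‖w'‖ ^ 2 := by nlinarith [norm_nonneg w']
  rw [div_eq_div_iff h1.ne' h2.ne'] at h
  have hsq : ‖w‖ ^ 2 = ‖w'‖ ^ 2 := by nlinarith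
  exact (sq_eq_sq₀ (norm_nonneg _) (norm_nonneg _)).1 hsq

/-! ### Invariance under `Aut(𝔻)` -/

/-- Rotations preserve `cosh ρ`. [cite: Beardon1983, Thm. 7.2.1] -/
theorem discCosh_mul {c : ℂ} (hc : ‖c‖ = 1) (z w : ℂ) : discCosh (c * z) (c * w) = discCosh z w := by
  rw [discCosh, discCosh, ← mul_sub, norm_mul, norm_mul, norm_mul, hc, one_mul, one_mul, one_mul]

/-- `φ_a z - φ_a w = (1 - |a|²)(z - w)/((1 - ā z)(1 - ā w))` (Beardon §7.2, the computation behind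
the invariance of `ρ`). [cite: Beardon1983, Thm. 7.2.1] -/
theorem discMobius_sub_discMobius {a z w : ℂ} (hz : 1 - conj a * z ≠ 0) (hw : 1 - conj a * w ≠ 0) :
    discMobius a z - discMobius a w =
      (1 - conj a * a) * (z - w) / ((1 - conj a * z) * (1 - conj a * w)) := by
  rw [discMobius, discMobius, div_sub_div _ _ hz hw]
  congr 1
  ring

/-- `1 - ‖φ_a z‖² = (1 - ‖a‖²)(1 - ‖z‖²)/‖1 - ā z‖²`. [cite: Beardon1983, Thm. 7.2.1] -/
theorem one_sub_norm_sq_discMobius {a z : ℂ} (hz : 1 - conj a * z ≠ 0) :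
    1 - ‖discMobius a z‖ ^ 2 = (1 - ‖a‖ ^ 2) * (1 - ‖z‖ ^ 2) / ‖1 - conj a * z‖ ^ 2 := by
  have hpos : 0 < ‖1 - conj a * z‖ ^ 2 := by positivity
  rw [discMobius, norm_div, div_pow, eq_div_iff hpos.ne', sub_mul, one_mul, div_mul_cancel₀ _ hpos.ne',
    norm_sq_one_sub_conj_mul_sub]

/-- The Möbius maps `φ_a` preserve `cosh ρ` on the disc (Beardon Thm. 7.2.1 / §7.4: `Aut(𝔻)`
acts by hyperbolic isometries). [cite: Beardon1983, Thm. 7.2.1] -/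
theorem discCosh_discMobius {a z w : ℂ} (ha : ‖a‖ < 1) (hz : ‖z‖ < 1) (hw : ‖w‖ < 1) :
    discCosh (discMobius a z) (discMobius a w) = discCosh z w := by
  have hz' := one_sub_conj_mul_ne_zero ha hz.le
  have hw' := one_sub_conj_mul_ne_zero ha hw.le
  have h1 : 0 < 1 - ‖z‖ ^ 2 := by nlinarith [norm_nonneg z]
  have h2 : 0 < 1 - ‖w‖ ^ 2 := by nlinarith [norm_nonneg w]
  have h3 : 0 < 1 - ‖a‖ ^ 2 := by nlinarith [norm_nonneg a]
  have hnz : 0 < ‖1 - conj a * z‖ := norm_pos_iff.2 hz'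
  have hnw : 0 < ‖1 - conj a * w‖ := norm_pos_iff.2 hw'
  rw [discCosh, discCosh, one_sub_norm_sq_discMobius hz', one_sub_norm_sq_discMobius hw',
    discMobius_sub_discMobius hz' hw', norm_div, norm_mul, norm_mul, one_sub_conj_mul_self,
    Complex.norm_real, Real.norm_of_nonneg h3.le]
  congr 1
  have hA : ‖1 - z * conj a‖ ≠ 0 := by rw [mul_comm]; exact hnz.ne'
  have hB : ‖1 - w * conj a‖ ≠ 0 := by rw [mul_comm]; exact hnw.ne'
  have hA' : ‖1 - conj a * z‖ ≠ 0 := hnz.ne'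
  have hB' : ‖1 - conj a * w‖ ≠ 0 := hnw.ne'
  field_simp

/-! ### Half-turns -/

/-- The **half-turn** (hyperbolic rotation by `π`) about `q ∈ 𝔻`: `σ_q = φ_{-q} ∘ (z ↦ -z) ∘ φ_q`,
the geodesic symmetry of the hyperbolic plane at `q` (Beardon §7.33). [cite: Beardon1983, §7.33] -/
def discHalfTurn (q z : ℂ) : ℂ :=
  discMobius (-q) (-discMobius q z)

/-- Unfolding the half-turn. [cite: Beardon1983, §7.33] -/
theorem discHalfTurn_apply (q z : ℂ) : discHalfTurn q z = discMobius (-q) (-discMobius q z) := rfl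

/-- The half-turn about `q` as a composite of automorphisms. [cite: Beardon1983, §7.33] -/
theorem discHalfTurn_eq_comp (q : ℂ) :
    discHalfTurn q = discMobius (-q) ∘ (fun z => (-1 : ℂ) * z) ∘ discMobius q := by
  ext z
  simp [discHalfTurn]

/-- The half-turn about `q ∈ 𝔻` maps the disc into the disc. [cite: Beardon1983, §7.33] -/
theorem norm_discHalfTurn_lt_one {q z : ℂ} (hq : ‖q‖ < 1) (hz : ‖z‖ < 1) :
    ‖discHalfTurn q z‖ < 1 := by
  have hq' : ‖-q‖ < 1 := by rwa [norm_neg]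
  rw [discHalfTurn]
  exact norm_discMobius_lt_one hq' (by rw [norm_neg]; exact norm_discMobius_lt_one hq hz)

/-- The half-turn about `q ∈ 𝔻` maps the disc into the disc (`MapsTo` form).
[cite: Beardon1983, §7.33] -/
theorem mapsTo_discHalfTurn {q : ℂ} (hq : ‖q‖ < 1) : MapsTo (discHalfTurn q) (ball 0 1) (ball 0 1) :=
  fun _ hz => mem_ball_zero_iff.2 (norm_discHalfTurn_lt_one hq (mem_ball_zero_iff.1 hz))

/-- The half-turn about `q` fixes `q`. [cite: Beardon1983, §7.33] -/
@[simp] theorem discHalfTurn_self (q : ℂ) : discHalfTurn q q = q := by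
  simp [discHalfTurn]

/-- The half-turn about `0` is `z ↦ -z`. [cite: Beardon1983, §7.33] -/
@[simp] theorem discHalfTurn_zero_left (z : ℂ) : discHalfTurn 0 z = -z := by
  simp [discHalfTurn, discMobius]

/-- The half-turn is an involution on the disc. [cite: Beardon1983, §7.33] -/
theorem discHalfTurn_discHalfTurn {q z : ℂ} (hq : ‖q‖ < 1) (hz : ‖z‖ < 1) :
    discHalfTurn q (discHalfTurn q z) = z := by
  have hq' : ‖-q‖ < 1 := by rwa [norm_neg]
  have h1 : ‖-discMobius q z‖ ≤ 1 := by
    rw [norm_neg]; exact (norm_discMobius_lt_one hq hz).le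
  rw [discHalfTurn, discHalfTurn]
  have key : discMobius q (discMobius (-q) (-discMobius q z)) = -discMobius q z := by
    simpa using discMobius_neg_discMobius hq' h1
  rw [key, neg_neg, discMobius_neg_discMobius hq hz.le]

/-- `σ_q(0) = (2/(1 + ‖q‖²))·q`: the half-turn about `q` moves the origin to the hyperbolic
"double" of `q`. [cite: Beardon1983, §7.33] -/
theorem discHalfTurn_apply_zero (q : ℂ) :
    discHalfTurn q 0 = (2 / (1 + conj q * q)) * q := by
  have hne : 1 + conj q * q ≠ 0 := by
    rw [conj_mul', ← ofReal_pow, ← ofReal_one, ← ofReal_add, ofReal_ne_zero]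
    positivity
  rw [discHalfTurn, discMobius_zero, neg_neg, discMobius, map_neg, neg_mul, sub_neg_eq_add,
    sub_neg_eq_add]
  field_simp
  ring

/-- `‖σ_q(0)‖ = 2‖q‖/(1 + ‖q‖²)`. [cite: Beardon1983, §7.33] -/
theorem norm_discHalfTurn_apply_zero (q : ℂ) :
    ‖discHalfTurn q 0‖ = 2 * ‖q‖ / (1 + ‖q‖ ^ 2) := by
  have hpos : 0 < 1 + ‖q‖ ^ 2 := by positivity
  rw [discHalfTurn_apply_zero q, conj_mul', ← ofReal_pow, ← ofReal_one, ← ofReal_add,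
    ← ofReal_ofNat, ← ofReal_div, norm_mul, Complex.norm_real, Real.norm_of_nonneg (by positivity)]
  ring

/-- **Doubling**: `cosh ρ(0, σ_q(0)) = 2 cosh² ρ(0,q) - 1`, i.e. `ρ(0, σ_q 0) = 2 ρ(0, q)`.
[cite: Beardon1983, §7.33] -/
theorem discCosh_zero_discHalfTurn_zero {q : ℂ} (hq : ‖q‖ < 1) :
    discCosh 0 (discHalfTurn q 0) = 2 * discCosh 0 q ^ 2 - 1 := by
  have hn : ‖discHalfTurn q 0‖ < 1 := norm_discHalfTurn_lt_one hq (by simp)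
  rw [discCosh_zero_left hn, discCosh_zero_left hq, norm_discHalfTurn_apply_zero q]
  have h1 : 0 < 1 - ‖q‖ ^ 2 := by nlinarith [norm_nonneg q]
  have h2 : 0 < 1 + ‖q‖ ^ 2 := by positivity
  have h3 : (1 + ‖q‖ ^ 2) ^ 2 - (2 * ‖q‖) ^ 2 = (1 - ‖q‖ ^ 2) ^ 2 := by ring
  rw [div_pow, one_sub_div (pow_ne_zero _ h2.ne'), one_add_div (pow_ne_zero _ h2.ne'), h3,
    div_div_div_cancel_right₀ (pow_ne_zero _ h2.ne')]
  field_simp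
  ring

/-- The half-turn about `q` is not the identity on the disc. [cite: Beardon1983, §7.33] -/
theorem not_eqOn_discHalfTurn_id {q : ℂ} (hq : ‖q‖ < 1) : ¬ EqOn (discHalfTurn q) id (ball 0 1) := by
  intro h
  have hq' : ‖-q‖ < 1 := by rwa [norm_neg]
  -- evaluate at `φ_{-q}(1/2)`
  set u : ℂ := 1 / 2 with hu
  have hun : ‖u‖ < 1 := by rw [hu]; norm_num
  have hu0 : u ≠ 0 := by rw [hu]; norm_num
  have hm : discMobius (-q) u ∈ ball (0 : ℂ) 1 := mapsTo_discMobius hq' (mem_ball_zero_iff.2 hun)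
  have h1 := h hm
  rw [id, discHalfTurn, show discMobius q (discMobius (-q) u) = u by
    simpa using discMobius_neg_discMobius hq' hun.le] at h1
  have h2 : -u = u := injOn_discMobius hq'
    (by simpa using (mem_ball_zero_iff.2 hun : u ∈ ball (0 : ℂ) 1)) (mem_ball_zero_iff.2 hun) h1
  exact hu0 (by linear_combination (-1 / 2 : ℂ) * h2)

/-! ### Points on a hyperbolic circle about the origin -/

/-- `cosh ρ` of two points `u·p`, `v·p` (`‖u‖ = ‖v‖ = 1`) on the circle through `p` about `0`:
`1 + 2‖p‖²‖u - v‖²/(1 - ‖p‖²)²` — affine in `‖u - v‖²`. [cite: Beardon1983, Thm. 7.2.1] -/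
theorem discCosh_mul_mul {u v : ℂ} (hu : ‖u‖ = 1) (hv : ‖v‖ = 1) (p : ℂ) :
    discCosh (u * p) (v * p) = 1 + 2 * (‖p‖ ^ 2 * ‖u - v‖ ^ 2) / (1 - ‖p‖ ^ 2) ^ 2 := by
  rw [discCosh, ← sub_mul, norm_mul, norm_mul, norm_mul, hu, hv, one_mul, mul_pow]
  ring

end Literature.Analysis.Complex
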